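import Summits.HodgeConjecture.CorCM.RelativePairFlipShadows
import Literature.AlgebraicGeometry.Pohlmann1968.SeparatingCMFamilies
import HarnessLib

/-!
# THE EXACT ADDITIVITY CRITERION FOR AN IRREDUCIBLE SLOT IN MATRIX-COEFFICIENT FORM: `Hg(A₀ × A₁) = Hg(A₀) × Hg(A₁)`
# iff the translate function `g ↦ u₀(g x₀)` is NOT a rational combination of the `g ↦ u₁(g y)`, `y ∈ Hom(K₁, ℂ)`

COR-CM (cell `pub-hodgecm2`, binder seat `b16` gen 52, count-neutral claim TOWER-SHADOW, file F8 — abstract `G`-set level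
(§1) and CM fields / abelian varieties (§2); theorems only, no definition, no named fact, no `sorry`).  NEW as stated, hence
under `Summits/`.  HONEST FRAMING: finite-dimensional linear algebra about the Kubota–Dodson rank of families of CM types
and its reading on products of CM abelian varieties; `HC_CM` is neither used nor asserted.

Frobenius reciprocity behind F1/F6, stated WITHOUT any map between the slots and WITHOUT any flip hypothesis.  Two slots
`I = {i₀, i₁}`, `G` acting on `X = E_{i₀}` and `Y = E_{i₁}`, CM types `Φ₀`, `Φ₁` for `ρ`, type vectors `u₀ = u_1(Φ₀)`,
`u₁ = u_1(Φ₁)` (`±1`), `U(Φ₀)` IRREDUCIBLE, `x₀ ∈ X` any base point.  Gen 51's Goursat dichotomy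
(`additive_or_exists_collapse_of_irreducible`) says: the pair is NOT additive iff some `G`-equivariant `L : ℚ^Y → ℚ^X` has
`L u₁ = u₀`.  Evaluating the kernel of such an `L` at `x₀` (`λ(y) = (L δ_y)(x₀)`) turns it into a vector `λ ∈ ℚ^Y` with
`Σ_y λ(y) u₁(g y) = u₀(g x₀)` for every `g ∈ G`; conversely such a `λ` feeds gen 49's separating functional
(`ParallelShadowsSlots`, with the `G`-set `Z = G` and the invariant kernels `[x = z x₀]`, `λ(z⁻¹ y)`).  Hence:

> **`forall_map_le_iff_not_exists_coeff`**.  The pair is ADDITIVE (`ext_i U(Φ_i) ≤ U(Σ)`, `rank(Σ) + 2 = rank Φ₀ + rank Φ₁ + 1`,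
> `Hg(A₀ × A₁) = Hg(A₀) × Hg(A₁)`) IFF there is NO `λ : Y → ℚ` with `Σ_y λ(y) · u₁(g y) = u₀(g x₀)` for all `g ∈ G` — the
> MATRIX COEFFICIENT `g ↦ u₀(g x₀)` of `Φ₀` is not a rational combination of the matrix coefficients `g ↦ u₁(g y)` of `Φ₁`.

A finite linear system once `G` is replaced by its image in `Sym(X) × Sym(Y)`; rank form
`typeRank_sigmaType_add_card_eq_iff_not_exists_coeff`, nondegeneracy form `typeRank_sigmaType_eq_iff_not_exists_coeff`.
F1/F6 computed the solutions `λ` when `Y → X` has relative pair flips / pointwise partial conjugations (then `λ` is forced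
to be `c · (𝟙_{r⁻¹x₀} − 𝟙_{r⁻¹ρx₀})` and the criterion becomes Yanai's constant unequal multiplicities); this file is the
hypothesis-free statement behind them.  §2, CM FIELDS: `K_{i₀}` with PAIR FLIPS (generic, `U(Φ₀)` irreducible) against ANY CM
field `K_{i₁}` of ANY degree, in ANY position — **`cmFamilyRank_add_card_eq_iff_not_exists_coeff_of_pairFlip`**,
**`isNondegenerateFamily_iff_not_exists_coeff_of_pairFlip`**, `cmFamilyRank_add_card_lt_of_coeff` (a solution `λ` makes
the pair degenerate, no flip hypothesis), and on abelian varieties **`hodgeConjectureFor_prod_of_pairFlip_of_not_exists_coeff`**,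
**`forall_prod_hodgeClassSpan_eq_iff_of_pairFlip_coeff`** (simple non-isogenous realisations).  This closes the DEGREE TABLE
of seat b16's pair-flip programme (gens 41–52) by a decidable criterion in the remaining rows (partners containing the
normal closure, reflex-type partners of larger degree, …).

## References

* [Gordon1999HodgeAVSurvey] B. B. Gordon, *A survey of the Hodge conjecture for abelian varieties*, §3 Theorem (Imai,
  Murty) with proof (the character computation), 7.4–7.7 (Murty, Hazama), 10.10.
* [Serre1977] J.-P. Serre, *Linear Representations of Finite Groups*, GTM 42, §2.2 (Schur), §7.2 (Frobenius reciprocity).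
* [Dodson1984] B. Dodson, *The structure of Galois groups of CM-fields*, Trans. AMS 283 (1984), §1.1, §5.1.2.
-/

set_option autoImplicit false

noncomputable section

open scoped BigOperators

universe u v

namespace Summit.HodgeConjecture.CorCM.Shadow

open Literature.NumberTheory.ComplexMultiplication
open scoped Classical

variable {G : Type u} [Group G]

/-! ### §1 Abstract slots -/

section Kernel

variable {X Y : Type*} [MulAction G X] [MulAction G Y] [Fintype X] [Fintype Y]

omit [Fintype X] in
/-- **A collapse map has a coefficient vector.**  If `L : ℚ^Y → ℚ^X` is `G`-equivariant with `L u_1(Φ₁) = u_1(Φ₀)`, then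
`λ(y) = (L δ_y)(x₀)` satisfies `Σ_y λ(y) u_1(Φ₁)(g y) = u_1(Φ₀)(g x₀)` for every `g` (expand `L` along its kernel and apply it
to the translate `y ↦ u_1(Φ₁)(g y)`). [cite: Serre1977, §7.2] [cite: Gordon1999HodgeAVSurvey, §3 Theorem (proof)] -/
theorem exists_coeff_of_collapse (Φ₀ : Set X) (Φ₁ : Set Y) (L : (Y → ℚ) →ₗ[ℚ] (X → ℚ))
    (hL : ∀ (g : G) (f : Y → ℚ), L (fun y => f (g • y)) = fun x => L f (g • x))
    (hLu : L (antiVec Φ₁ (1 : G)) = antiVec Φ₀ (1 : G)) (x₀ : X) :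
    ∃ lam : Y → ℚ, ∀ g : G, ∑ y, lam y * antiVec Φ₁ (1 : G) (g • y) = antiVec Φ₀ (1 : G) (g • x₀) := by
  refine ⟨fun y => L (Pi.single y 1) x₀, fun g => ?_⟩
  -- expansion of `(L f)(x₀)` along the kernel
  have hexp : ∀ f : Y → ℚ, L f x₀ = ∑ y, f y * L (Pi.single y 1) x₀ := by
    intro f
    have hf : f = ∑ y, f y • (Pi.single y (1 : ℚ) : Y → ℚ) := by
      funext y'
      rw [Finset.sum_apply]
      simp only [Pi.smul_apply, Pi.single_apply, smul_eq_mul, mul_ite, mul_one, mul_zero]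
      rw [Finset.sum_ite_eq Finset.univ y' f, if_pos (Finset.mem_univ _)]
    conv_lhs => rw [hf]
    rw [map_sum, Finset.sum_apply]
    refine Finset.sum_congr rfl fun y _ => ?_
    rw [map_smul, Pi.smul_apply, smul_eq_mul]
  have h1 := congrFun (hL g (antiVec Φ₁ (1 : G))) x₀
  rw [hLu] at h1
  change L (fun y => antiVec Φ₁ (1 : G) (g • y)) x₀ = antiVec Φ₀ (1 : G) (g • x₀) at h1
  rw [hexp] at h1
  rw [← h1]
  exact Finset.sum_congr rfl fun y _ => mul_comm _ _

end Kernel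

section Family

variable {I : Type v} {E : I → Type v} [∀ i, MulAction G (E i)] [DecidableEq I] [Fintype I] [∀ i, Fintype (E i)]
  {ρ : G} {Φ : ∀ i, Set (E i)} {i₀ i₁ : I} [Nonempty I] [∀ i, Nonempty (E i)]

omit [DecidableEq I] in
/-- **A coefficient vector makes the rank non-additive** (gen 49's separating functional with `Z = G`, kernels
`[x = z • x₀]` and `λ(z⁻¹ • y)`): `rank(Σ) + |I| < Σ_i rank(Φ_i) + 1`.  No hypothesis on the slots beyond `i₀ ≠ i₁`.
[cite: Gordon1999HodgeAVSurvey, §3 Theorem (proof) and 7.5] -/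
theorem typeRank_sigmaType_add_card_lt_of_coeff (h : ∀ i, IsCMTypeWith ρ (Φ i)) (h01 : i₀ ≠ i₁) {x₀ : E i₀}
    {lam : E i₁ → ℚ} (hlam : ∀ g : G, ∑ y, lam y * antiVec (Φ i₁) (1 : G) (g • y) = antiVec (Φ i₀) (1 : G) (g • x₀)) :
    typeRank G (sigmaType Φ) + Fintype.card I < (∑ i, typeRank G (Φ i)) + 1 := by
  refine typeRank_sigmaType_add_card_lt_of_parallel h h01 (Z := G) (fun z x => if x = z • x₀ then (1 : ℚ) else 0)
    (fun z y => lam (z⁻¹ • y)) (fun g z x => ?_) (fun g z y => ?_) 1 (fun z => ?_) (z₀ := (1 : G)) ?_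
  · -- invariance of `[x = z • x₀]`
    have hiff : g • x = (g • z) • x₀ ↔ x = z • x₀ := by
      rw [smul_eq_mul, mul_smul]
      exact ⟨fun hx => smul_left_cancel g hx, fun hx => by rw [hx]⟩
    by_cases hx : x = z • x₀
    · rw [if_pos hx, if_pos (hiff.2 hx)]
    · rw [if_neg hx, if_neg (fun h' => hx (hiff.1 h'))]
  · -- invariance of `λ(z⁻¹ • y)`
    show lam ((g • z)⁻¹ • g • y) = lam (z⁻¹ • y)
    rw [smul_eq_mul, mul_inv_rev, mul_smul, inv_smul_smul]
  · -- the two shadows at `z`: `u₀(z x₀)` and `Σ_y λ(y) u₁(z y)`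
    have h0 : ∑ x, (if x = z • x₀ then (1 : ℚ) else 0) * antiVec (Φ i₀) (1 : G) x = antiVec (Φ i₀) (1 : G) (z • x₀) := by
      simp only [ite_mul, one_mul, zero_mul, Finset.sum_ite_eq', Finset.mem_univ, if_true]
    have h1 : ∑ y, lam (z⁻¹ • y) * antiVec (Φ i₁) (1 : G) y = ∑ y, lam y * antiVec (Φ i₁) (1 : G) (z • y) := by
      refine Fintype.sum_equiv (MulAction.toPerm z⁻¹) _ _ fun y => ?_
      simp only [MulAction.toPerm_apply, smul_inv_smul]
    rw [h0, h1, one_mul, hlam z]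
  · have h0 : ∑ x, (if x = (1 : G) • x₀ then (1 : ℚ) else 0) * antiVec (Φ i₀) (1 : G) x =
        antiVec (Φ i₀) (1 : G) ((1 : G) • x₀) := by
      simp only [ite_mul, one_mul, zero_mul, Finset.sum_ite_eq', Finset.mem_univ, if_true]
    rw [h0]
    exact antiVec_ne_zero (Φ i₀) (1 : G) _

/-- **THE EXACT ADDITIVITY CRITERION FOR AN IRREDUCIBLE SLOT (matrix-coefficient form).**  `I = {i₀, i₁}`, `U(Φ_{i₀})`
irreducible, `x₀ ∈ E_{i₀}` arbitrary: both slot extensions lie in `U(Σ)` (`Hg(A₀ × A₁) = Hg(A₀) × Hg(A₁)`) IFF there is NO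
`λ : E_{i₁} → ℚ` with `Σ_y λ(y) u_1(Φ_{i₁})(g y) = u_1(Φ_{i₀})(g x₀)` for all `g ∈ G`.  No flip, transitivity or map hypothesis.
[cite: Gordon1999HodgeAVSurvey, §3 Theorem (proof) and 7.5–7.7] [cite: Serre1977, §2.2 and §7.2] -/
theorem forall_map_le_iff_not_exists_coeff (h : ∀ i, IsCMTypeWith ρ (Φ i)) (hI : ∀ j, j = i₀ ∨ j = i₁) (h01 : i₀ ≠ i₁)
    (hirr : ∀ W : Submodule ℚ (E i₀ → ℚ), W ≤ antiSpan G (Φ i₀) → W ≠ ⊥ →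
      (∀ (k : G) (f : E i₀ → ℚ), f ∈ W → (fun y => f (k • y)) ∈ W) → W = antiSpan G (Φ i₀))
    (x₀ : E i₀) :
    (∀ i, (antiSpan G (Φ i)).map (slotExt i) ≤ antiSpan G (sigmaType Φ)) ↔
      ¬ ∃ lam : E i₁ → ℚ, ∀ g : G, ∑ y, lam y * antiVec (Φ i₁) (1 : G) (g • y) = antiVec (Φ i₀) (1 : G) (g • x₀) := by
  constructor
  · rintro hadd ⟨lam, hlam⟩
    have h1 := typeRank_sigmaType_add_card_eq_of_forall_map_le h hadd
    have h2 := typeRank_sigmaType_add_card_lt_of_coeff h h01 hlam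
    omega
  · intro hnot
    rcases PairFlipTransport.additive_or_exists_collapse_of_irreducible hI h01 hirr with hadd | ⟨L, hL, -, hLu⟩
    · exact hadd
    · exact absurd (exists_coeff_of_collapse (Φ i₀) (Φ i₁) L hL hLu x₀) hnot

/-- **Rank form**: `rank(Σ) + |I| = Σ_i rank(Φ_i) + 1` IFF no coefficient vector exists.
[cite: Gordon1999HodgeAVSurvey, §3 Theorem (1) and 7.5–7.7] -/
theorem typeRank_sigmaType_add_card_eq_iff_not_exists_coeff (h : ∀ i, IsCMTypeWith ρ (Φ i))
    (hI : ∀ j, j = i₀ ∨ j = i₁) (h01 : i₀ ≠ i₁)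
    (hirr : ∀ W : Submodule ℚ (E i₀ → ℚ), W ≤ antiSpan G (Φ i₀) → W ≠ ⊥ →
      (∀ (k : G) (f : E i₀ → ℚ), f ∈ W → (fun y => f (k • y)) ∈ W) → W = antiSpan G (Φ i₀))
    (x₀ : E i₀) :
    typeRank G (sigmaType Φ) + Fintype.card I = (∑ i, typeRank G (Φ i)) + 1 ↔
      ¬ ∃ lam : E i₁ → ℚ, ∀ g : G, ∑ y, lam y * antiVec (Φ i₁) (1 : G) (g • y) = antiVec (Φ i₀) (1 : G) (g • x₀) := by
  constructor
  · rintro heq ⟨lam, hlam⟩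
    have h2 := typeRank_sigmaType_add_card_lt_of_coeff h h01 hlam
    omega
  · intro hnot
    exact typeRank_sigmaType_add_card_eq_of_forall_map_le h ((forall_map_le_iff_not_exists_coeff h hI h01 hirr x₀).2 hnot)

/-- **Nondegeneracy form**: with `Φ_{i₀}` nondegenerate, `Σ` is nondegenerate IFF `Φ_{i₁}` is nondegenerate and no
coefficient vector exists. [cite: Gordon1999HodgeAVSurvey, 7.5–7.7] -/
theorem typeRank_sigmaType_eq_iff_not_exists_coeff (h : ∀ i, IsCMTypeWith ρ (Φ i)) (hI : ∀ j, j = i₀ ∨ j = i₁)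
    (h01 : i₀ ≠ i₁)
    (hirr : ∀ W : Submodule ℚ (E i₀ → ℚ), W ≤ antiSpan G (Φ i₀) → W ≠ ⊥ →
      (∀ (k : G) (f : E i₀ → ℚ), f ∈ W → (fun y => f (k • y)) ∈ W) → W = antiSpan G (Φ i₀))
    (hnd₀ : typeRank G (Φ i₀) = Fintype.card (E i₀) / 2 + 1) (x₀ : E i₀) :
    typeRank G (sigmaType Φ) = Fintype.card (Σ i, E i) / 2 + 1 ↔
      typeRank G (Φ i₁) = Fintype.card (E i₁) / 2 + 1 ∧
        ¬ ∃ lam : E i₁ → ℚ, ∀ g : G,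
          ∑ y, lam y * antiVec (Φ i₁) (1 : G) (g • y) = antiVec (Φ i₀) (1 : G) (g • x₀) := by
  constructor
  · intro hnd
    refine ⟨typeRank_eq_of_typeRank_sigmaType_eq h hnd i₁, fun ⟨lam, hlam⟩ => ?_⟩
    have h1 := typeRank_sigmaType_add_card_eq_of_forall_map_le h
      (forall_map_slotExt_le_of_typeRank_sigmaType_eq h hnd)
    have h2 := typeRank_sigmaType_add_card_lt_of_coeff h h01 hlam
    omega
  · rintro ⟨hnd₁, hnot⟩
    rw [typeRank_sigmaType_eq_iff_forall_of_forall_map_le h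
      ((forall_map_le_iff_not_exists_coeff h hI h01 hirr x₀).2 hnot)]
    intro i
    rcases hI i with rfl | rfl
    · exact hnd₀
    · exact hnd₁

end Family

end Summit.HodgeConjecture.CorCM.Shadow

/-! ### §2 CM fields: a pair-flip field against ANY CM field -/

namespace Summit.HodgeConjecture.CorCM

open CategoryTheory CategoryTheory.Limits NumberField Module
open Literature.NumberTheory.ComplexMultiplication
open Literature.AlgebraicGeometry.Motives (AbelianVariety CMType)
open Literature.AlgebraicGeometry.HodgeTheory
open Literature.AlgebraicGeometry.ComplexMultiplication (IsCMTypeRealisation)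
open Literature.AlgebraicGeometry.VanGeemen1994 (hodgeClassSpan)
open Literature.AlgebraicGeometry.Pohlmann1968
open Literature.Barriers.HodgeConjecture (divisorClassesSpan)
open scoped Classical

variable {I : Type} {K : I → Type} [∀ i, Field (K i)] [∀ i, NumberField (K i)] [∀ i, IsCMField (K i)] [Fintype I]
  [DecidableEq I] {Φ : ∀ i, CMType (K i)} {i₀ i₁ : I}

omit [∀ i, IsCMField (K i)] [DecidableEq I] in
/-- `|⊔_i Hom(K_i, ℂ)| = Σ_i [K_i : ℚ]`. [folklore] -/
private theorem card_sigma_ringHom_eq_sum₅₂'' : Fintype.card ((i : I) × (K i →+* ℂ)) = ∑ i, finrank ℚ (K i) := by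
  rw [Fintype.card_sigma]
  exact Finset.sum_congr rfl fun i _ => Embeddings.card (K i) ℂ

omit [DecidableEq I] in
/-- **A coefficient vector makes the pair degenerate** (no flip hypothesis, any two CM fields): if
`Σ_y λ(y) · u_{Φ₁}(g ∘ y) = u_{Φ₀}(g ∘ x₀)` for all automorphisms `g` of `ℂ` (`u_Φ = 𝟙_Φ − 𝟙_{Φ̄}`), then
`rank(Φ₀, Φ₁) + 2 < rank Φ₀ + rank Φ₁ + 1`. [cite: Gordon1999HodgeAVSurvey, §3 Theorem (proof) and 7.5] -/
theorem cmFamilyRank_add_card_lt_of_coeff (h01 : i₀ ≠ i₁) {x₀ : K i₀ →+* ℂ} {lam : (K i₁ →+* ℂ) → ℚ}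
    (hlam : ∀ g : ℂ ≃+* ℂ,
      ∑ y, lam y * antiVec (Φ i₁).1 (1 : ℂ ≃+* ℂ) (g • y) = antiVec (Φ i₀).1 (1 : ℂ ≃+* ℂ) (g • x₀)) :
    CMAlgebra.cmFamilyRank Φ + Fintype.card I < (∑ i, cmTypeRank (Φ i)) + 1 :=
  haveI : Nonempty I := ⟨i₀⟩
  Shadow.typeRank_sigmaType_add_card_lt_of_coeff (G := ℂ ≃+* ℂ) (Φ := fun i => (Φ i).1)
    (fun i => isCMTypeWith_conj (Φ i)) h01 hlam

/-- **THE EXACT CRITERION for a pair-flip field against ANY CM field.**  `I = {i₀, i₁}`, `K_{i₀}` with PAIR FLIPS (generic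
CM field of its degree), `K_{i₁}` ANY CM field, `x₀ : K_{i₀} → ℂ` any embedding: `rank(Φ₀, Φ₁) + 2 = rank Φ₀ + rank Φ₁ + 1`
(`Hg(A₀ × A₁) = Hg(A₀) × Hg(A₁)`) IFF there is NO `λ : Hom(K_{i₁}, ℂ) → ℚ` with `Σ_y λ(y) u_{Φ₁}(g ∘ y) = u_{Φ₀}(g ∘ x₀)` for all
automorphisms `g` of `ℂ`. [cite: Gordon1999HodgeAVSurvey, §3 Theorem (1) and 7.5–7.7] [cite: Dodson1984, §5.1.2] -/
theorem cmFamilyRank_add_card_eq_iff_not_exists_coeff_of_pairFlip (hI : ∀ i, i = i₀ ∨ i = i₁) (h01 : i₀ ≠ i₁)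
    (hflip₀ : ∀ x : K i₀ →+* ℂ, ∃ σ : ℂ ≃+* ℂ, σ • x = (starRingAut : ℂ ≃+* ℂ) • x ∧
      ∀ x' : K i₀ →+* ℂ, x' ≠ x → x' ≠ (starRingAut : ℂ ≃+* ℂ) • x → σ • x' = x') (x₀ : K i₀ →+* ℂ) :
    CMAlgebra.cmFamilyRank Φ + Fintype.card I = (∑ i, cmTypeRank (Φ i)) + 1 ↔
      ¬ ∃ lam : (K i₁ →+* ℂ) → ℚ, ∀ g : ℂ ≃+* ℂ,
        ∑ y, lam y * antiVec (Φ i₁).1 (1 : ℂ ≃+* ℂ) (g • y) = antiVec (Φ i₀).1 (1 : ℂ ≃+* ℂ) (g • x₀) := by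
  haveI := isPretransitive_ringEquiv_complex (K := K i₀)
  haveI : Nonempty I := ⟨i₀⟩
  exact Shadow.typeRank_sigmaType_add_card_eq_iff_not_exists_coeff (G := ℂ ≃+* ℂ) (Φ := fun i => (Φ i).1)
    (fun i => isCMTypeWith_conj (Φ i)) hI h01 (antiSpan_irreducible_of_pairFlip (isCMTypeWith_conj (Φ i₀)) hflip₀) x₀

/-- **Nondegeneracy form**: `K_{i₀}` with pair flips, `K_{i₁}` any CM field: the pair `(Φ₀, Φ₁)` is nondegenerate IFF `Φ₁`
is nondegenerate and no coefficient vector `λ` exists. [cite: Gordon1999HodgeAVSurvey, 7.5–7.7] [cite: Dodson1984, §5.1.2] -/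
theorem isNondegenerateFamily_iff_not_exists_coeff_of_pairFlip (hI : ∀ i, i = i₀ ∨ i = i₁) (h01 : i₀ ≠ i₁)
    (hflip₀ : ∀ x : K i₀ →+* ℂ, ∃ σ : ℂ ≃+* ℂ, σ • x = (starRingAut : ℂ ≃+* ℂ) • x ∧
      ∀ x' : K i₀ →+* ℂ, x' ≠ x → x' ≠ (starRingAut : ℂ ≃+* ℂ) • x → σ • x' = x') (x₀ : K i₀ →+* ℂ) :
    CMAlgebra.IsNondegenerateFamily Φ ↔ IsNondegenerate (Φ i₁) ∧
      ¬ ∃ lam : (K i₁ →+* ℂ) → ℚ, ∀ g : ℂ ≃+* ℂ,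
        ∑ y, lam y * antiVec (Φ i₁).1 (1 : ℂ ≃+* ℂ) (g • y) = antiVec (Φ i₀).1 (1 : ℂ ≃+* ℂ) (g • x₀) := by
  haveI := isPretransitive_ringEquiv_complex (K := K i₀)
  haveI : Nonempty I := ⟨i₀⟩
  have hnd₀ : typeRank (ℂ ≃+* ℂ) (Φ i₀).1 = Fintype.card (K i₀ →+* ℂ) / 2 + 1 :=
    typeRank_eq_of_pairFlip (isCMTypeWith_conj (Φ i₀)) hflip₀
  have key := Shadow.typeRank_sigmaType_eq_iff_not_exists_coeff (G := ℂ ≃+* ℂ) (Φ := fun i => (Φ i).1)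
    (fun i => isCMTypeWith_conj (Φ i)) hI h01 (antiSpan_irreducible_of_pairFlip (isCMTypeWith_conj (Φ i₀)) hflip₀)
    hnd₀ x₀
  rw [CMAlgebra.isNondegenerateFamily_iff, ← card_sigma_ringHom_eq_sum₅₂'' (K := K), isNondegenerate_iff, cmTypeRank,
    ← Embeddings.card (K i₁) ℂ]
  exact key

section Varieties

variable [Nonempty I] {A : I → AbelianVariety ℂ} {ι : ∀ i, 𝓞 (K i) →+* End (A i)}
  {θ : ∀ i, K i →+* Module.End ℂ (complexBetti (A i).X 1)}

/-- **The Hodge conjecture on every `A₀^a × A₁^b`**, with `B• = D•` there, for realisations of a type of a pair-flip CM field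
and a NONDEGENERATE type of ANY CM field with NO coefficient vector — UNCONDITIONALLY.
[cite: Gordon1999HodgeAVSurvey, 7.5 and 10.10] -/
theorem hodgeConjectureFor_prod_of_pairFlip_of_not_exists_coeff (hI : ∀ i, i = i₀ ∨ i = i₁) (h01 : i₀ ≠ i₁)
    (hflip₀ : ∀ x : K i₀ →+* ℂ, ∃ σ : ℂ ≃+* ℂ, σ • x = (starRingAut : ℂ ≃+* ℂ) • x ∧
      ∀ x' : K i₀ →+* ℂ, x' ≠ x → x' ≠ (starRingAut : ℂ ≃+* ℂ) • x → σ • x' = x') (x₀ : K i₀ →+* ℂ)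
    (hnd : IsNondegenerate (Φ i₁))
    (hnot : ¬ ∃ lam : (K i₁ →+* ℂ) → ℚ, ∀ g : ℂ ≃+* ℂ,
      ∑ y, lam y * antiVec (Φ i₁).1 (1 : ℂ ≃+* ℂ) (g • y) = antiVec (Φ i₀).1 (1 : ℂ ≃+* ℂ) (g • x₀))
    (hA : ∀ i, IsCMTypeRealisation (Φ i) (A i) (ι i) (θ i)) {N : ℕ} (π : Fin N → I) :
    HodgeConjectureFor (⨁ fun j : Fin N => A (π j)).dim (⨁ fun j : Fin N => A (π j)).X ∧
      ∀ m : ℕ, hodgeClassSpan (⨁ fun j : Fin N => A (π j)).dim (⨁ fun j : Fin N => A (π j)).X m =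
        divisorClassesSpan (⨁ fun j : Fin N => A (π j)).X (⨁ fun j : Fin N => A (π j)).dim m :=
  have h := (isNondegenerateFamily_iff_not_exists_coeff_of_pairFlip hI h01 hflip₀ x₀).2 ⟨hnd, hnot⟩
  ⟨h.hodgeConjectureFor_prod hA π, fun m => h.hodgeClassSpan_prod_eq_divisorClassesSpan hA π m⟩

/-- **SIMPLE, NON-ISOGENOUS realisations (pair-flip field against any CM field): `B• = D•` on ALL products `A₀^a × A₁^b`
IFF `Φ₁` is nondegenerate and no coefficient vector exists**; otherwise some product carries an exceptional Hodge class.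
[cite: Gordon1999HodgeAVSurvey, 7.5 and 7.6.1] -/
theorem forall_prod_hodgeClassSpan_eq_iff_of_pairFlip_coeff (hI : ∀ i, i = i₀ ∨ i = i₁) (h01 : i₀ ≠ i₁)
    (hflip₀ : ∀ x : K i₀ →+* ℂ, ∃ σ : ℂ ≃+* ℂ, σ • x = (starRingAut : ℂ ≃+* ℂ) • x ∧
      ∀ x' : K i₀ →+* ℂ, x' ≠ x → x' ≠ (starRingAut : ℂ ≃+* ℂ) • x → σ • x' = x') (x₀ : K i₀ →+* ℂ)
    (hA : ∀ i, IsCMTypeRealisation (Φ i) (A i) (ι i) (θ i)) (hs : ∀ i, (A i).IsSimple)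
    (hniso : ∀ i i', i ≠ i' → ¬ AbelianVariety.IsIsogenous (A i) (A i')) :
    (∀ (N : ℕ) (π : Fin N → I) (m : ℕ),
      hodgeClassSpan (⨁ fun j : Fin N => A (π j)).dim (⨁ fun j : Fin N => A (π j)).X m =
        divisorClassesSpan (⨁ fun j : Fin N => A (π j)).X (⨁ fun j : Fin N => A (π j)).dim m) ↔
      IsNondegenerate (Φ i₁) ∧ ¬ ∃ lam : (K i₁ →+* ℂ) → ℚ, ∀ g : ℂ ≃+* ℂ,
        ∑ y, lam y * antiVec (Φ i₁).1 (1 : ℂ ≃+* ℂ) (g • y) = antiVec (Φ i₀).1 (1 : ℂ ≃+* ℂ) (g • x₀) := by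
  rw [← CMAlgebra.isNondegenerateFamily_iff_forall_prod_hodgeClassSpan_eq
    (CMAlgebra.isSeparatingFamily_of_isSimple_of_pairwise_not_isIsogenous hA hs hniso) hA]
  exact isNondegenerateFamily_iff_not_exists_coeff_of_pairFlip hI h01 hflip₀ x₀

end Varieties

end Summit.HodgeConjecture.CorCM

end
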